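import Literature.AnabelianGeometry.SemiGraphs.ThetaRayCritical
import Literature.AnabelianGeometry.SemiGraphs.ThetaRayEscapeCoincidence
import Literature.AnabelianGeometry.SemiGraphs.ThetaRayGraphFreeProP
import Literature.AnabelianGeometry.SemiGraphs.ThetaRayFreeProP
import Literature.AnabelianGeometry.SemiGraphs.ThetaRayFreeProPQuasiCoherent
import Literature.AnabelianGeometry.SemiGraphs.FreeProPRankTwoLevels
import Literature.AnabelianGeometry.SemiGraphs.TemperedLevelKernelCharOpenCore
import HarnessLib

/-!
# `¬ CompactInVerticial`: the ∀-countable reading of [SemiAnbd] Thm 3.7 (iii) fails at `𝒢_θ` (REFUTE-F1732, R7)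

Mochizuki, *Semi-graphs of anabelioids*, Publ. RIMS **42** (2006) [MochizukiSemiAnbd2006], §3,
Theorem 3.7 (iii), author's manuscript pp. 40–41 ("Every compact subgroup of `π₁^temp(𝒢)` is contained
in at least one verticial subgroup"), hypotheses p. 40 ("connected, countable, quasi-coherent, totally
elevated, totally estranged, verticially slim") as amended by [IUTchI] Rmk 2.5.3 (i)/(E7)
(Galois-countability) [cite: MochizukiSemiAnbd2006, Thm 3.7(iii) pp.40-41].  The printed PROOF (p. 41
l. 30 "Since the semi-graphs `𝔾_j` are all finite …", Comments (2020) (6)) is a proof for FINITE underlying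
semi-graphs — the cell's kernel theorem `compactInVerticialAt_of_finiteGraph` (p431007) — and the IUT
papers only ever apply Thm 3.7 to finite dual semi-graphs.  The cell's named fact `CompactInVerticial`
(F-1732) typed the statement for ALL countable semi-graphs of anabelioids satisfying the printed
hypotheses; THIS FILE REFUTES THAT ∀-COUNTABLE READING IN THE KERNEL:

* `ProfiniteSemiGraph.thetaRayFreeProP_not_compactInVerticialAt` — at the countermodel `𝒢_θ(p, n)` of
  abc-iut-L3-d1 (memo COUNTERMODEL-Thm37iii-infinite.md sha16 8b26b5199c29f55f, four concurring readers):
  the ray `ℕ` of free pro-`p` groups `F̂₂⁽ᵖ⁾ = ⟨a, b⟩` glued along `ℤ_p` by `1 ↦ a` (upper branch) and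
  `1 ↦ a·b^{p^{n_k}}` (lower branch), `k ≤ n_k` — a connected, countable, Galois-countable, quasi-coherent,
  totally elevated, totally estranged, verticially slim graph of anabelioids (bricks R1–R5) — the compact
  procyclic subgroup `C = closure⟨lim_k z_k⟩` of `π₁^temp(𝒢_θ)` (canonical chart), `z_k` the edge
  generators of the base apartment, lies in NO verticial subgroup: its fixed loci on the trees `𝒢_{∞,j}`
  escape along the ray;
* `ProfiniteSemiGraph.not_compactInVerticial : ¬ CompactInVerticial.{0}`.

FRONTIER programme REFUTE-F1732 (plan/L3/SUBDAG-SemiAnbd-Thm37iii-REFUTE.md, L3-lead; bricks: R0 t6 p432161 ·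
R1 w6-d019 (+t7, d215) · R2 d096/t7 · R3 w6-d070 · R4 w4-d075 · R5 w6-d102 · R6 abc-iut-L3-d4 (p437307
p437320 p438249 p440079 p441714) with L3-t5 (limit) / w4-d071 (compactness) / L3-t11 + w5-d160 (apartment,
branch stabilisers, level data p439805) / L3-t6 (hK) · junction L3-t10).  PROOF-ONLY assembly file
(abc-iut-L3-d4, R7; 0 definitions, no named fact, no hypothesis beyond `Fact p.Prime`).
HONEST FRAMING: this is an ERRATUM-GRADE result about the ∀-countable TYPING of a published statement whose
printed proof (and every use in [IUTchI–IV]) concerns finite semi-graphs, where the statement is a kernel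
THEOREM; it refutes nothing in the IUT corpus and bears in no way on [IUTchIII] Cor. 3.12.
-/

noncomputable section

namespace Literature.AnabelianGeometry.SemiGraphs

namespace ProfiniteSemiGraph

open Topology Multiplicative
open Literature.AnabelianGeometry.SemiGraphs.FreeProPRankTwo

variable (p : ℕ) [hp : Fact p.Prime] (n : ℕ → ℕ)

/-- `Thm37Hypotheses 𝒢_θ(p, n)`, UNCONDITIONAL (bricks R1–R5: Galois-countable and quasi-coherent by the
characteristic splitters, totally elevated by the abelian approximators, totally estranged/aloof by the
abelianisation and malnormality, verticially slim). [cite: MochizukiSemiAnbd2006, Thm 3.7 p.40] -/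
theorem thetaRayFreeProP_thm37Hypotheses' : (thetaRayFreeProP p n).Thm37Hypotheses :=
  thetaRayFreeProP_thm37Hypotheses p n
    (thetaRayFreeProP_isGaloisCountable p (α p) (α_ofAdd_one p) (fun m => θHom p m)
      (fun m => (θ p m).bijective) n)
    (thetaRayFreeProP_isQuasiCoherent p (α p) (α_ofAdd_one p) (fun m => θHom p m)
      (fun m => (θ p m).bijective) n)
    (thetaRayFreeProP_isTotallyElevated_concrete p n)
    (thetaRayFreeProP_isTotallyAloof_concrete p n)
    (thetaRayFreeProP_isTotallyEstranged_concrete p n)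

/-- **[SemiAnbd] Thm 3.7 (iii), first clause, FAILS at `𝒢_θ(p, n)`** (`k ≤ n k`): there is a compact subgroup
of `π₁^temp(𝒢_θ)` (canonical chart) contained in no verticial subgroup.
[cite: MochizukiSemiAnbd2006, Thm 3.7(iii) pp.40-41] -/
theorem thetaRayFreeProP_not_compactInVerticialAt (hn : ∀ k, k ≤ n k) :
    ¬ CompactInVerticialAt (thetaRayFreeProP p n) := by
  classical
  haveI : NeZero p := ⟨hp.out.ne_zero⟩
  have h37 : (thetaRayFreeProP p n).Thm37Hypotheses := thetaRayFreeProP_thm37Hypotheses' p n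
  have h36 : (thetaRayFreeProP p n).Prop36Hypotheses := h37.toProp36Hypotheses
  -- a base point sequence over `v_0`
  obtain ⟨P₀⟩ := thetaRay_nonempty_pointSeq_zero (G := Grp p) (E := Multiplicative ℤ_[p]) (up := α p)
    (low := fun k => θα p (n k)) h36
  -- strict coherence (for abc-iut-L3-t6's level kernels)
  have hsc : (thetaRayFreeProP p n).IsStrictlyCoherent :=
    thetaRayFreeProP_isStrictlyCoherent p (α p) (α_ofAdd_one p) (fun m => θHom p m)
      (fun m => (θ p m).bijective) n
  -- (hcoin): `(θ_{n(k+1)} a)⁻¹ a = b^{-p^{n(k+1)}} → 1` through the characteristic open cores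
  have hcoin : ∀ d : ℕ, ∃ N : ℕ, ∀ k, N ≤ k →
      ((fun k => θα p (n k)) (k + 1) (ofAdd (1 : ℤ_[p])))⁻¹ * α p (ofAdd 1) ∈ charOpenCore (Grp p) d :=
    thetaRayOfTwists_hcoin (α := α p) (θ := fun m => θHom p m) (n := n) (ofAdd (1 : ℤ_[p])) (b := b p)
      (p := p) (fun m => by rw [α_ofAdd_one, θHom_apply, θ_a]) hn
      (fun d => exists_pow_prime_pow_mem p _ (FreeProPRankTwo.isOpen_charOpenCore p d) (b p))
  -- the level data: characters `χaMod (e m)`, abelianisations `abMod (e m)`, `e m := n (m+1) + 1`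
  refine thetaRay_not_compactInVerticialAt_of_characters (G := Grp p) (E := Multiplicative ℤ_[p])
    (up := α p) (low := fun k => θα p (n k))
    (A := fun m => Multiplicative (ZMod (p ^ (n (m + 1) + 1))))
    (V := fun m => Multiplicative (ZMod (p ^ (n (m + 1) + 1)) × ZMod (p ^ (n (m + 1) + 1))))
    h37 P₀ (ofAdd 1) hcoin (fun m => χaMod p (n (m + 1) + 1)) ?_
    (fun m => (abMod p (n (m + 1) + 1)).toMonoidHom) ?_ ?_
  · -- hχA: the characters are compatible with the gluings (`χaMod` is `θ`-invariant)
    intro m k t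
    change χaMod p _ (θ p (n k) (α p t)) = χaMod p _ (α p t)
    rw [χaMod_θ]
  · -- hK: at deep levels the point stabilisers lie in the characteristic core `⊆ ker (abMod e)` (L3-t6)
    intro m
    obtain ⟨j₀, hj₀⟩ := (thetaRayFreeProP p n).exists_level_hK h36 hsc (p ^ (2 * (n (m + 1) + 1)))
    exact ⟨j₀, fun j hj w P x hx =>
      hj₀ j hj w P (abMod p (n (m + 1) + 1)).toMonoidHom (charOpenCore_le_ker_abMod p _) x hx⟩
  · -- hsep: the model arithmetic `(u, p^{n_{m+1}} u) ≠ (u, 0)` in `(ℤ/p^e)²`, `n_{m+1} < e`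
    intro m t₁ t₂ h₁ h₂
    exact abMod_θ_α_ne_abMod_α_of_lt p (Nat.lt_succ_self _) t₁ t₂ h₁ h₂

/-- **`¬ CompactInVerticial`**: the cell's ∀-countable typing (named fact F-1732) of [SemiAnbd] Thm 3.7 (iii)
is FALSE — countermodel `𝒢_θ(p, k ↦ k + 1)` for any prime `p` (here `p = 2`).  The printed theorem for
FINITE semi-graphs (`compactInVerticialAt_of_finiteGraph`) is unaffected.
[cite: MochizukiSemiAnbd2006, Thm 3.7(iii) pp.40-41] -/
theorem not_compactInVerticial : ¬ CompactInVerticial.{0} := fun h =>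
  haveI : Fact (Nat.Prime 2) := ⟨Nat.prime_two⟩
  thetaRayFreeProP_not_compactInVerticialAt 2 (fun k => k + 1) (fun k => Nat.le_succ k)
    (compactInVerticial_iff_forall_at.mp h _)

end ProfiniteSemiGraph

end Literature.AnabelianGeometry.SemiGraphs

end

-- tree-health (abc-iut-w6-d081 g4, 2026-08-26T12:44Z): comment-only re-land of a STRANDED ACCEPT (module accepted, not importable on the farm for > 60 min);
-- declarations byte-identical to the accepted version; purpose = trigger the rebuild (w4-d014 10:34:09Z remedy class). No content change.
-- tree-health (abc-iut-w6-d081 g4, 2026-08-26T14:24Z): second comment-only re-land — the 12:44Z re-land batch did not regain a farm olean in 95 min while the 12:55Z and 13:5xZ batches did within ≈20 min (suspected dispatch gap at 12:44Z); declarations byte-identical.
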